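import Summits.QuantumFields.YangMills.Theorems.BalabanUVNodesN15SmallFieldSiteLayerAnyPropagator
import HarnessLib

/-!
# N15 = NE2 — PROGRAMME 𝟙P «ONE PROPAGATOR», part (𝟙P-c′): THE SITE LAYER FOR ANY INNER PROPAGATOR FAMILY AT ANY TWO-GRID RATE `γ_X ∈ (0, 1∕16]` — (𝟙P-c) `ne2PlusSite_foSiteAny` with the
# exponent `1∕16` of its displayed comparison rows made a parameter
# (dag-n15-a g32, FILE (𝟙P-c′); node N15 = NE2; `--supports stmt-QuantumFields-27366 --as helper`, count-neutral; ONE theorem; imports (𝟙P-c))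

WHY.  (𝟙P-c) displays the two-grid defect row of the inner propagator family (`hX` (iii)) and the comparison rows of the averaging perturbation family (`hfam`) at the lane's conventional η-rate
`(L^k)^{−1∕16}` (FILE 21 conjunct 6).  dag-n15-c's (P-R) family — Bałaban's Landau summand `D_U R(U) D*_U` live — carries its Landau η-defect row at a rate `(L^k)^{−γ_R}` with `γ_R > 0`
DISPLAYED (n15-c∕211 `ne2PlusOperator_sfqr_of_global`, hypothesis `hG`).  To read that family in the site layer BY NAME without asking `γ_R ≥ 1∕16`, the exponent must be a parameter: this
file is (𝟙P-c)'s theorem with `1∕16 ↦ γ_X`, `0 < γ_X ≤ 1∕16` — the proof uses the rate only through `(L^k)^{−1} ≤ (L^k)^{−γ_X} ≤ 1` (two `norm_num` side goals become `hγX`, `hγX16`) and weakens (𝟙P-b)'s hard-wired comparison factor `(L^k)^{−1∕16}` of the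
averaging family's increments to `(L^k)^{−γ_X}` (`γ_X ≤ 1∕16`, `L^k ≥ 1`) — whence the range `(0, 1∕16]`; every `γ_R > 0` is served at `γ_X = min γ_R (1∕16)`.

WHAT.  ★★★ `ne2PlusSite_foSiteAny_rate … (hγX : 0 < γX) (hγX16 : γX ≤ 1/16) (hX) (hfam) : NE2PlusSite d′ p c₃₅ (sfInstance d mm ι hL) (foSiteAny d mm ι a hL α β j j′ Xc Xf Dc Ec Df Ef)`, constants
`(max(w_X,1), δ_S, a₀, C_S(K(K_X + 3 + 2K_D) + 1) + 1, γ_X)`.  (𝟙P-c) is the case `γ_X = 1∕16` (not re-derived; both stay).  Rows at exponent `1∕16` feed any `γ_X ≤ 1∕16` by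
`(L^k)^{−1∕16} ≤ (L^k)^{−γ_X}` (the knit does this weakening, not this file).

HONEST FRAMING ∕ LIMITS.  No new estimate — a re-parametrisation of (𝟙P-c); the inner propagator and the averaging perturbation are DISPLAYED by rows; MODEL carriers of dag-n15-c (two-spacing glued
doubled torus, global small-field gauge, `Reg336` idle, King-block-mean pairing, `L ≥ 7`, crude constants); the η-rate inequality is NOT PRINTED ([B9] Thm 3.14 = domain differences); NOT [B9]
Thm 3.2 AS PRINTED.  N15 stays DISCHARGED OF RECORD 8∕28 AS CONSUMED (p687738) — no re-pin, nothing re-claimed, no count moved; K3⁸ OPEN; finite 𝕋⁴ per index — NOT ℝ⁴ ∕ OS ∕ mass gap ∕ Clay.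
`set_option maxHeartbeats 800000 in` ×1 ((𝟙P-c)'s budget).  No `sorry`, `instance`, `notation`; standard axioms.
[cite: Balaban1985BackgroundPropagators, Thm 3.2 (3.48) p.398 + (3.132) p.422 + Thm 3.14 pp.426–427 (quantifier template, shapes), (3.62)–(3.65) pp.402–403, (3.35) p.396; King1986, Prop. 3.9 (3.73) p.665 (rate factor),
Lemma 4.5 (4.38)–(4.41) pp.674–675 (mechanism); CombesThomas1973, §II (mechanism)]
-/

noncomputable section

open scoped BigOperators Matrix Matrix.Norms.Frobenius Kronecker

namespace Summit.QuantumFields.YangMills.BalabanUVNodes.N15.SiteLayerSf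

open Literature.MathematicalPhysics.QuantumFieldTheory.Balaban1983to89
open Literature.MathematicalPhysics.QuantumFieldTheory.King1986 (exp_decay_mono)
open Literature.MathematicalPhysics.QuantumFieldTheory.Balaban1983to89.T4EtaRate (PairedInstance NE2PlusSite EtaRateIneqSite rateFactor)
open Literature.MathematicalPhysics.QuantumFieldTheory.Balaban1983to89.T4EtaRateDefect (rateWeight idef)
open Literature.MathematicalPhysics.QuantumFieldTheory.Balaban1983to89.T4EtaRateCoeffDefect (pull)
open Literature.MathematicalPhysics.QuantumFieldTheory.Balaban1983to89.B11SectG (BlockNorm HasMaj)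
open Literature.MathematicalPhysics.QuantumFieldTheory.Balaban1983to89.B5Prop11Plancherel (Tor fine)
open Literature.MathematicalPhysics.QuantumFieldTheory.Balaban1983to89.B6Lemma24Torus (pbox)
open Literature.MathematicalPhysics.QuantumFieldTheory.Balaban1983to89.B6BondEliminationTorus (pdist)
open Literature.MathematicalPhysics.QuantumFieldTheory.Balaban1983to89.B6Cov2156Torus (deltaPol one_le_M)
open Literature.MathematicalPhysics.QuantumFieldTheory.Balaban1983to89.B6LowerBound2153Torus (rep rep_mem_pbox)
open Literature.MathematicalPhysics.QuantumFieldTheory.Balaban1983to89.B6UnitTorusCarrier (unitTorusGeo unitTorusGeo_dist_nonneg pdist_rep_rep)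
open Literature.MathematicalPhysics.QuantumFieldTheory.King1986.Torus (blockOf tdistT tdistT_nonneg)
open Literature.Barriers.QuantumFields (traceForm)
open Summit.QuantumFields.YangMills.BalabanUVNodes.N15.OperatorReadout (opGeo)
open Summit.QuantumFields.YangMills.BalabanUVNodes.N15.GenuineSite (etaRateIneqSite_opGeo_unit)
open Summit.QuantumFields.YangMills.BalabanUVNodes.N15.SiteLayer (hasMaj_exp_mono)
open Summit.QuantumFields.YangMills.BalabanUVNodes.N15.VectorPiece (bshiftEquiv kingPrV tensorId unitTorusGeoS rateWeight_unitTorusGeoS blkFine_comp_kingPrV)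
open Summit.QuantumFields.YangMills.BalabanUVNodes.N15.MatrixSpecies (basisConst basisConst_nonneg liftBlk liftMap)
open Summit.QuantumFields.YangMills.BalabanUVNodes.N15.UnitLayerBgCol (cdist cdist_eq cdist_nonneg siteC siteC_apply siteC_zero siteC_sub_letters unitBondMatC)
open Summit.QuantumFields.YangMills.BalabanUVNodes.N15.BackgroundLayer (gavgM)
open Summit.QuantumFields.YangMills.BalabanUVNodes.N15.TwoGrid (gOp qvRe qvAdjRe)
open Summit.QuantumFields.YangMills.BalabanUVNodes.N15.Gluing (SfIdx sfGeo sfInstance sfInstance_reg335_iff sfInstance_gf_M CvX CvX' cvM cvBlk CvNorm cvNL cvNL' cvGlued cvGlued')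
open Summit.QuantumFields.YangMills.BalabanUVNodes.N15.GluedZeroField (zAnyC zAnyF exists_zAny_letters)

variable (d : ℕ) {L : ℕ} [NeZero L] (mm ι : Type) [Fintype mm] [Fintype ι] [DecidableEq ι] (a : ℝ)

/-! ## ★★★ `NE2PlusSite` by name for any inner propagator family, any two-grid rate -/

section SiteLayerRate

set_option maxHeartbeats 800000 in
/-- ★★★ **`NE2PlusSite` BY NAME FOR THE U-LIVE SITE KERNEL READING AN ARBITRARY INNER PROPAGATOR FAMILY — ANY η-RATE `γ_X ∈ (0, 1∕16]`.**  (𝟙P-c) `ne2PlusSite_foSiteAny`'s statement and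
proof text VERBATIM with the two-grid exponent `1∕16` of the displayed rows (`hX` (iii) and (Q-3)'s comparison rows of `hfam`) replaced by a parameter `γ_X` (`0 < γ_X ≤ 1∕16`): for odd `L ≥ 7`,
`a, c₃₅ > 0`, `ι` nonempty, `|Xc i A′ − G⊗1|, |Xf i A′ − G′⊗1| ≤ K_X·(c₃₅L^mα₀)·e^{−ρ_X d}`, `|𝔇(Xf i A′ − G′⊗1, Xc i A′ − G⊗1)| ≤ K_X·(L^k)^{−γ_X}·e^{−ρ_X d}` (window `c₃₅L^mα₀ ≤ s_X`, cubes
`L^m ≥ w_X`) and the perturbation family's six rows (sizes `K_D·(c₃₅L^mα₀)`, comparisons `K_D·(L^k)^{−γ_X}`, every rate) ⟹ `NE2PlusSite d′ p c₃₅ (sfInstance d mm ι hL) (foSiteAny … Xc Xf Dc Ec Df Ef)`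
with `(M₅, δ, a₀, C, γ) = (max(w_X,1), δ_S, a₀, C_S(K(K_X + 3 + 2K_D) + 1) + 1, γ_X)`.  The rate is used only through `(L^k)^{−1} ≤ (L^k)^{−γ_X} ≤ 1` and `(L^k)^{−1∕16} ≤ (L^k)^{−γ_X}` ((𝟙P-b)'s hard-wired comparison factor).  USE: a propagator family whose
two-grid defect row comes at a rate other than `1∕16` (the (P-R) family: dag-n15-c∕211's Landau η-defect row at `γ_R`) meets the site layer at `γ_X = min γ_R (1∕16)`.  MODEL objects; NOT
[B9] Thm 3.2 as printed.
[cite: Balaban1985BackgroundPropagators, Thm 3.2 (3.48) p.398 («with the same constants») + (3.132) p.422 + Thm 3.14 pp.426–427 (quantifier template, shapes), (3.62)–(3.65) pp.402–403, (3.78)–(3.81) p.406, (3.35) p.396; Balaban1984PropagatorsI, (1.66) p.29,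
(1.102)–(1.103) p.34; King1986, Prop. 3.9 (3.73) p.665 (rate factor), Lemma 4.5 (4.38)–(4.41) pp.674–675 (mechanism); CombesThomas1973, §II (mechanism)] -/
theorem ne2PlusSite_foSiteAny_rate [Nonempty ι] (hL : Odd L ∧ 1 < L) (hL7 : 7 ≤ L) (ha : 0 < a) {c35 : ℝ} (hc35 : 0 < c35) (α β : Fin (d + 1)) (j j' : ι) (d' : ℕ) (p : ℝ)
    (Xc : ∀ i : SfIdx d L, (Fin (d + 1) → CvX' d L i.m i.kk i.r hL → Matrix mm mm ℂ) → ((CvX d L i.m i.kk hL × ι → ℝ) →ₗ[ℝ] (CvX d L i.m i.kk hL × ι → ℝ)))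
    (Xf : ∀ i : SfIdx d L, (Fin (d + 1) → CvX' d L i.m i.kk i.r hL → Matrix mm mm ℂ) → ((CvX' d L i.m i.kk i.r hL × ι → ℝ) →ₗ[ℝ] (CvX' d L i.m i.kk i.r hL × ι → ℝ)))
    (Dc : ∀ i : SfIdx d L, (Fin (d + 1) → CvX' d L i.m i.kk i.r hL → Matrix mm mm ℂ) → ((CvX d L i.m i.kk hL × ι → ℝ) →ₗ[ℝ] ((Tor (cvM d L i.m i.kk hL) × Fin (d + 1)) × ι → ℝ)))
    (Ec : ∀ i : SfIdx d L, (Fin (d + 1) → CvX' d L i.m i.kk i.r hL → Matrix mm mm ℂ) → (((Tor (cvM d L i.m i.kk hL) × Fin (d + 1)) × ι → ℝ) →ₗ[ℝ] (CvX d L i.m i.kk hL × ι → ℝ)))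
    (Df : ∀ i : SfIdx d L, (Fin (d + 1) → CvX' d L i.m i.kk i.r hL → Matrix mm mm ℂ) → ((CvX' d L i.m i.kk i.r hL × ι → ℝ) →ₗ[ℝ] ((Tor (cvM d L i.m i.kk hL) × Fin (d + 1)) × ι → ℝ)))
    (Ef : ∀ i : SfIdx d L, (Fin (d + 1) → CvX' d L i.m i.kk i.r hL → Matrix mm mm ℂ) → (((Tor (cvM d L i.m i.kk hL) × Fin (d + 1)) × ι → ℝ) →ₗ[ℝ] (CvX' d L i.m i.kk i.r hL × ι → ℝ)))
    {γX : ℝ} (hγX : 0 < γX) (hγX16 : γX ≤ 1 / 16)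
    (hX : ∃ ρX KX wX sX : ℝ, 0 < ρX ∧ 0 ≤ KX ∧ 0 < sX ∧
      ∀ (i : SfIdx d L) (α₀ : ℝ) (A' : Fin (d + 1) → CvX' d L i.m i.kk i.r hL → Matrix mm mm ℂ), 0 < α₀ → wX ≤ ((L ^ i.m : ℕ) : ℝ) → c35 * (L : ℝ) ^ i.m * α₀ ≤ sX →
        (sfInstance d mm ι hL i).Bf.Reg335 c35 α₀ A' →
        HasMaj (CvNorm d L i.m i.kk hL ι) (CvNorm d L i.m i.kk hL ι) (Xc i A' - tensorId ι (gOp (cvM d L i.m i.kk hL) (L ^ i.kk) a))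
          (fun y y' => KX * (c35 * (L : ℝ) ^ i.m * α₀) * Real.exp (-(ρX * (unitTorusGeo L i.kk (cvM d L i.m i.kk hL)).dist y y'))) ∧
        HasMaj (BlockNorm.ofBlocks (unitTorusGeo L i.kk (cvM d L i.m i.kk hL)) (liftBlk (fun b : CvX' d L i.m i.kk i.r hL => blockOf (L ^ i.r * L ^ i.kk) (cvM d L i.m i.kk hL) b.1) ι))
          (BlockNorm.ofBlocks (unitTorusGeo L i.kk (cvM d L i.m i.kk hL)) (liftBlk (fun b : CvX' d L i.m i.kk i.r hL => blockOf (L ^ i.r * L ^ i.kk) (cvM d L i.m i.kk hL) b.1) ι))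
          (Xf i A' - tensorId ι (gOp (cvM d L i.m i.kk hL) (L ^ i.r * L ^ i.kk) a))
          (fun y y' => KX * (c35 * (L : ℝ) ^ i.m * α₀) * Real.exp (-(ρX * (unitTorusGeo L i.kk (cvM d L i.m i.kk hL)).dist y y'))) ∧
        HasMaj (CvNorm d L i.m i.kk hL ι)
          (BlockNorm.ofBlocks (unitTorusGeo L i.kk (cvM d L i.m i.kk hL)) (liftBlk (fun b : CvX' d L i.m i.kk i.r hL => blockOf (L ^ i.r * L ^ i.kk) (cvM d L i.m i.kk hL) b.1) ι))
          (idef (pull (liftMap (kingPrV L i.kk i.r (cvM d L i.m i.kk hL)) ι)) (pull (liftMap (kingPrV L i.kk i.r (cvM d L i.m i.kk hL)) ι))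
            (Xf i A' - tensorId ι (gOp (cvM d L i.m i.kk hL) (L ^ i.r * L ^ i.kk) a)) (Xc i A' - tensorId ι (gOp (cvM d L i.m i.kk hL) (L ^ i.kk) a)))
          (fun y y' => KX * ((((L ^ i.kk : ℕ) : ℝ)) ^ (-γX)) * Real.exp (-(ρX * (unitTorusGeo L i.kk (cvM d L i.m i.kk hL)).dist y y'))))
    (hfam : ∀ ρ : ℝ, 0 < ρ → ∃ KD s₀ : ℝ, 0 ≤ KD ∧ 0 < s₀ ∧
      ∀ (i : SfIdx d L) (α₀ : ℝ) (A' : Fin (d + 1) → CvX' d L i.m i.kk i.r hL → Matrix mm mm ℂ), 0 < α₀ → c35 * (L : ℝ) ^ i.m * α₀ ≤ s₀ → (sfInstance d mm ι hL i).Bf.Reg335 c35 α₀ A' →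
        HasMaj (CvNorm d L i.m i.kk hL ι) (BlockNorm.ofBlocks (unitTorusGeo L i.kk (cvM d L i.m i.kk hL)) (liftBlk (fun b : Tor (cvM d L i.m i.kk hL) × Fin (d + 1) => b.1) ι)) (Dc i A')
          (fun y y' => KD * (c35 * (L : ℝ) ^ i.m * α₀) * Real.exp (-(ρ * (unitTorusGeo L i.kk (cvM d L i.m i.kk hL)).dist y y'))) ∧
        HasMaj (BlockNorm.ofBlocks (unitTorusGeo L i.kk (cvM d L i.m i.kk hL)) (liftBlk (fun b : CvX' d L i.m i.kk i.r hL => blockOf (L ^ i.r * L ^ i.kk) (cvM d L i.m i.kk hL) b.1) ι))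
          (BlockNorm.ofBlocks (unitTorusGeo L i.kk (cvM d L i.m i.kk hL)) (liftBlk (fun b : Tor (cvM d L i.m i.kk hL) × Fin (d + 1) => b.1) ι)) (Df i A')
          (fun y y' => KD * (c35 * (L : ℝ) ^ i.m * α₀) * Real.exp (-(ρ * (unitTorusGeo L i.kk (cvM d L i.m i.kk hL)).dist y y'))) ∧
        HasMaj (BlockNorm.ofBlocks (unitTorusGeo L i.kk (cvM d L i.m i.kk hL)) (liftBlk (fun b : Tor (cvM d L i.m i.kk hL) × Fin (d + 1) => b.1) ι)) (CvNorm d L i.m i.kk hL ι) (Ec i A')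
          (fun y y' => KD * (c35 * (L : ℝ) ^ i.m * α₀) * Real.exp (-(ρ * (unitTorusGeo L i.kk (cvM d L i.m i.kk hL)).dist y y'))) ∧
        HasMaj (BlockNorm.ofBlocks (unitTorusGeo L i.kk (cvM d L i.m i.kk hL)) (liftBlk (fun b : Tor (cvM d L i.m i.kk hL) × Fin (d + 1) => b.1) ι))
          (BlockNorm.ofBlocks (unitTorusGeo L i.kk (cvM d L i.m i.kk hL)) (liftBlk (fun b : CvX' d L i.m i.kk i.r hL => blockOf (L ^ i.r * L ^ i.kk) (cvM d L i.m i.kk hL) b.1) ι)) (Ef i A')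
          (fun y y' => KD * (c35 * (L : ℝ) ^ i.m * α₀) * Real.exp (-(ρ * (unitTorusGeo L i.kk (cvM d L i.m i.kk hL)).dist y y'))) ∧
        HasMaj (CvNorm d L i.m i.kk hL ι) (BlockNorm.ofBlocks (unitTorusGeo L i.kk (cvM d L i.m i.kk hL)) (liftBlk (fun b : Tor (cvM d L i.m i.kk hL) × Fin (d + 1) => b.1) ι))
          (Df i A' ∘ₗ pull (liftMap (kingPrV L i.kk i.r (cvM d L i.m i.kk hL)) ι) - Dc i A')
          (fun y y' => KD * ((((L ^ i.kk : ℕ) : ℝ)) ^ (-γX)) * Real.exp (-(ρ * (unitTorusGeo L i.kk (cvM d L i.m i.kk hL)).dist y y'))) ∧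
        HasMaj (BlockNorm.ofBlocks (unitTorusGeo L i.kk (cvM d L i.m i.kk hL)) (liftBlk (fun b : Tor (cvM d L i.m i.kk hL) × Fin (d + 1) => b.1) ι))
          (BlockNorm.ofBlocks (unitTorusGeo L i.kk (cvM d L i.m i.kk hL)) (liftBlk (fun b : CvX' d L i.m i.kk i.r hL => blockOf (L ^ i.r * L ^ i.kk) (cvM d L i.m i.kk hL) b.1) ι))
          (Ef i A' - pull (liftMap (kingPrV L i.kk i.r (cvM d L i.m i.kk hL)) ι) ∘ₗ Ec i A')
          (fun y y' => KD * ((((L ^ i.kk : ℕ) : ℝ)) ^ (-γX)) * Real.exp (-(ρ * (unitTorusGeo L i.kk (cvM d L i.m i.kk hL)).dist y y')))) :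
    NE2PlusSite d' p c35 (sfInstance d mm ι hL) (foSiteAny d mm ι a hL α β j j' Xc Xf Dc Ec Df Ef) := by
  have hLpos : 0 < L := Nat.pos_of_ne_zero (NeZero.ne L)
  have hLr : (0 : ℝ) < (L : ℝ) := Nat.cast_pos.mpr hLpos
  have hL1 : (1 : ℝ) ≤ (L : ℝ) := by exact_mod_cast hLpos
  -- the four constant packages: the propagator family's rows, (𝟙P-b)'s letters at that rate (rate `ρ` for the averaging rows), the averaging family's constant at `ρ`, (J-c′)'s site letter
  obtain ⟨ρX, KX, wX, sX, hρX, hKX, hsX, HXr⟩ := hX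
  obtain ⟨ρ, δz, Kz, hρ, -, hδz, hKz, HZ⟩ := exists_zAny_letters d ι a hL ha hρX
  obtain ⟨KD, s₀, hKD, hs₀, HD⟩ := hfam ρ hρ
  obtain ⟨C, δS, ζ₀, hC, hδS, hζ₀, HS⟩ := siteC_sub_letters d (Fintype.card ι) ha hδz
  -- the thresholds: `a_ζ` (`K_Z(K_X + 2K_D) r_A ≤ ζ₀`), `a_X` (`K_X r_A ≤ 1`), `a_D` (`K_D r_A ≤ 1`), `a_SX` (`r_A ≤ s_X`), `a_S` (`r_A ≤ s₀`)
  let aζ : ℝ := ζ₀ / (Kz * (KX + 2 * KD + 1) * c35)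
  have haζ : 0 < aζ := by positivity
  let aX : ℝ := 1 / ((KX + 1) * c35)
  have haX : 0 < aX := by positivity
  let aD : ℝ := 1 / ((KD + 1) * c35)
  have haD : 0 < aD := by positivity
  let aSX : ℝ := sX / c35
  have haSX : 0 < aSX := by positivity
  let aS : ℝ := s₀ / c35
  have haS0 : 0 < aS := by positivity
  let a₀ : ℝ := min (min (min aζ aX) (min aD aSX)) aS
  have ha₀ : 0 < a₀ := lt_min (lt_min (lt_min haζ haX) (lt_min haD haSX)) haS0
  have ha₀ζ : a₀ ≤ aζ := ((min_le_left _ _).trans (min_le_left _ _)).trans (min_le_left _ _)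
  have ha₀X : a₀ ≤ aX := ((min_le_left _ _).trans (min_le_left _ _)).trans (min_le_right _ _)
  have ha₀D : a₀ ≤ aD := ((min_le_left _ _).trans (min_le_right _ _)).trans (min_le_left _ _)
  have ha₀SX : a₀ ≤ aSX := ((min_le_left _ _).trans (min_le_right _ _)).trans (min_le_right _ _)
  have ha₀S : a₀ ≤ aS := min_le_right _ _
  let M₁ : ℝ := max wX 1
  have hM₁ : 0 < M₁ := lt_of_lt_of_le one_pos (le_max_right _ _)
  refine ⟨M₁, δS, a₀, C * (Kz * (KX + 3 + 2 * KD) + 1) + 1, γX, hM₁, hδS, ha₀, by positivity, hγX, fun i hM α₀ hα₀ hMa A' hA' => ?_⟩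
  -- the index's scalar facts
  rw [sfInstance_gf_M] at hM hMa
  have hwX : wX ≤ ((L ^ i.m : ℕ) : ℝ) := by push_cast; exact (le_max_left _ _).trans hM
  have hx1 : (1 : ℝ) ≤ (L : ℝ) ^ i.kk := one_le_pow₀ hL1
  have hxpos : (0 : ℝ) < (L : ℝ) ^ i.kk := pow_pos hLr _
  have hcast : (((L ^ i.kk : ℕ) : ℝ)) = (L : ℝ) ^ i.kk := by push_cast; rfl
  have hLk : 1 ≤ L ^ i.kk := Nat.one_le_pow _ _ hLpos
  have hLrr : 1 ≤ L ^ i.r := Nat.one_le_pow _ _ hLpos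
  have hγX1 : γX ≤ 1 := hγX16.trans (by norm_num)
  set t : ℝ := ((L : ℝ) ^ i.kk) ^ (-γX) with ht_def
  have ht0 : 0 ≤ t := Real.rpow_nonneg hxpos.le _
  have hθt : (((L ^ i.kk : ℕ) : ℝ)) ^ (-γX) = t := by rw [hcast]
  have hinv : ((((L ^ i.kk : ℕ) : ℝ)))⁻¹ ≤ t := by
    rw [hcast, ← Real.rpow_neg_one]; exact Real.rpow_le_rpow_of_exponent_le hx1 (neg_le_neg hγX1)
  have hη0 : 0 ≤ ((((L ^ i.kk : ℕ) : ℝ)))⁻¹ := by positivity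
  have hθ0 : 0 ≤ (((L ^ i.kk : ℕ) : ℝ)) ^ (-γX) := by rw [hθt]; exact ht0
  have ht1 : t ≤ 1 := by
    rw [ht_def]; exact Real.rpow_le_one_of_one_le_of_nonpos hx1 (neg_nonpos.mpr hγX.le)
  -- the field scale `r_A = c₃₅L^mα₀` and the rows of both families there
  have hrA0 : 0 ≤ c35 * (L : ℝ) ^ i.m * α₀ := by positivity
  have hrAa : c35 * (L : ℝ) ^ i.m * α₀ ≤ c35 * a₀ := by
    rw [mul_assoc]; exact mul_le_mul_of_nonneg_left hMa hc35.le
  have hrS : c35 * (L : ℝ) ^ i.m * α₀ ≤ s₀ := by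
    calc c35 * (L : ℝ) ^ i.m * α₀ ≤ c35 * aS := hrAa.trans (mul_le_mul_of_nonneg_left ha₀S hc35.le)
      _ = s₀ := by
          show c35 * (s₀ / c35) = s₀
          field_simp
  have hrSX : c35 * (L : ℝ) ^ i.m * α₀ ≤ sX := by
    calc c35 * (L : ℝ) ^ i.m * α₀ ≤ c35 * aSX := hrAa.trans (mul_le_mul_of_nonneg_left ha₀SX hc35.le)
      _ = sX := by
          show c35 * (sX / c35) = sX
          field_simp
  obtain ⟨hDc, hDf, hEc, hEf, hDd, hEd⟩ := HD i α₀ A' hα₀ hrS hA'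
  obtain ⟨hYc, hYf, hYd⟩ := HXr i α₀ A' hα₀ hwX hrSX hA'
  -- the margins: `K_X r_A ≤ 1`, `K_D r_A ≤ 1`, `K_Z(K_X + 2K_D) r_A ≤ ζ₀`
  have hXr1 : KX * (c35 * (L : ℝ) ^ i.m * α₀) ≤ 1 := by
    calc KX * (c35 * (L : ℝ) ^ i.m * α₀) ≤ (KX + 1) * (c35 * aX) :=
          mul_le_mul (by linarith) (hrAa.trans (mul_le_mul_of_nonneg_left ha₀X hc35.le)) hrA0 (by positivity)
      _ = 1 := by
          show (KX + 1) * (c35 * (1 / ((KX + 1) * c35))) = 1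
          field_simp
  have hDr1 : KD * (c35 * (L : ℝ) ^ i.m * α₀) ≤ 1 := by
    calc KD * (c35 * (L : ℝ) ^ i.m * α₀) ≤ (KD + 1) * (c35 * aD) :=
          mul_le_mul (by linarith) (hrAa.trans (mul_le_mul_of_nonneg_left ha₀D hc35.le)) hrA0 (by positivity)
      _ = 1 := by
          show (KD + 1) * (c35 * (1 / ((KD + 1) * c35))) = 1
          field_simp
  have hζle : Kz * (KX * (c35 * (L : ℝ) ^ i.m * α₀) + KD * (c35 * (L : ℝ) ^ i.m * α₀) + KD * (c35 * (L : ℝ) ^ i.m * α₀)) ≤ ζ₀ := by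
    have hre : Kz * (KX * (c35 * (L : ℝ) ^ i.m * α₀) + KD * (c35 * (L : ℝ) ^ i.m * α₀) + KD * (c35 * (L : ℝ) ^ i.m * α₀)) =
        Kz * (KX + 2 * KD) * (c35 * (L : ℝ) ^ i.m * α₀) := by ring
    rw [hre]
    calc Kz * (KX + 2 * KD) * (c35 * (L : ℝ) ^ i.m * α₀) ≤ Kz * (KX + 2 * KD + 1) * (c35 * aζ) :=
          mul_le_mul (mul_le_mul_of_nonneg_left (by linarith) hKz.le) (hrAa.trans (mul_le_mul_of_nonneg_left ha₀ζ hc35.le)) hrA0 (by positivity)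
      _ = ζ₀ := by
          show Kz * (KX + 2 * KD + 1) * (c35 * (ζ₀ / (Kz * (KX + 2 * KD + 1) * c35))) = ζ₀
          field_simp
  have hρX0 : 0 ≤ KX * (c35 * (L : ℝ) ^ i.m * α₀) := by positivity
  have hθX0 : 0 ≤ KX * ((((L ^ i.kk : ℕ) : ℝ)) ^ (-γX)) := mul_nonneg hKX hθ0
  have hρD0 : 0 ≤ KD * (c35 * (L : ℝ) ^ i.m * α₀) := by positivity
  have hτD0 : 0 ≤ KD * ((((L ^ i.kk : ℕ) : ℝ)) ^ (-γX)) := mul_nonneg hKD hθ0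
  have hζ0 : 0 ≤ Kz * (KX * (c35 * (L : ℝ) ^ i.m * α₀) + KD * (c35 * (L : ℝ) ^ i.m * α₀) + KD * (c35 * (L : ℝ) ^ i.m * α₀)) := by positivity
  have hτ0 : 0 ≤ Kz * (KX * ((((L ^ i.kk : ℕ) : ℝ)) ^ (-γX)) +
      (KX * (c35 * (L : ℝ) ^ i.m * α₀) + KD * (c35 * (L : ℝ) ^ i.m * α₀) + KD * (c35 * (L : ℝ) ^ i.m * α₀)) * ((((L ^ i.kk : ℕ) : ℝ)) ^ (-γX)) +
      KD * ((((L ^ i.kk : ℕ) : ℝ)) ^ (-γX)) + KD * ((((L ^ i.kk : ℕ) : ℝ)) ^ (-γX))) := by positivity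
  -- (𝟙P-b): the three letters of the middle factors at this index, potential, propagator and averaging family
  obtain ⟨hZ, hZ', hZZ⟩ := HZ i.m i.kk i.r i.one_le (Xc i A') (Xf i A') (KX * (c35 * (L : ℝ) ^ i.m * α₀)) (KX * ((((L ^ i.kk : ℕ) : ℝ)) ^ (-γX)))
    hρX0 hXr1 hθX0 hYc hYf hYd (Dc i A') (Ec i A') (Df i A') (Ef i A')
    (KD * (c35 * (L : ℝ) ^ i.m * α₀)) (KD * (c35 * (L : ℝ) ^ i.m * α₀)) (KD * ((((L ^ i.kk : ℕ) : ℝ)) ^ (-γX))) (KD * ((((L ^ i.kk : ℕ) : ℝ)) ^ (-γX)))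
    hρD0 hDr1 hρD0 hDr1 hτD0 hτD0 hDc hDf hEc hEf hDd hEd
  -- the letters' hard-wired two-grid exponent `1∕16` weakened to `γ_X ≤ 1∕16`
  have h16 : (((L ^ i.kk : ℕ) : ℝ)) ^ (-(1 / 16 : ℝ)) ≤ (((L ^ i.kk : ℕ) : ℝ)) ^ (-γX) := by
    rw [hcast]; exact Real.rpow_le_rpow_of_exponent_le hx1 (neg_le_neg hγX16)
  have hmid : Kz * (KX * ((((L ^ i.kk : ℕ) : ℝ)) ^ (-γX)) +
      (KX * (c35 * (L : ℝ) ^ i.m * α₀) + KD * (c35 * (L : ℝ) ^ i.m * α₀) + KD * (c35 * (L : ℝ) ^ i.m * α₀)) * ((((L ^ i.kk : ℕ) : ℝ)) ^ (-(1 / 16 : ℝ))) +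
      KD * ((((L ^ i.kk : ℕ) : ℝ)) ^ (-γX)) + KD * ((((L ^ i.kk : ℕ) : ℝ)) ^ (-γX))) ≤
      Kz * (KX * ((((L ^ i.kk : ℕ) : ℝ)) ^ (-γX)) +
      (KX * (c35 * (L : ℝ) ^ i.m * α₀) + KD * (c35 * (L : ℝ) ^ i.m * α₀) + KD * (c35 * (L : ℝ) ^ i.m * α₀)) * ((((L ^ i.kk : ℕ) : ℝ)) ^ (-γX)) +
      KD * ((((L ^ i.kk : ℕ) : ℝ)) ^ (-γX)) + KD * ((((L ^ i.kk : ℕ) : ℝ)) ^ (-γX))) := by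
    have hS0 : 0 ≤ KX * (c35 * (L : ℝ) ^ i.m * α₀) + KD * (c35 * (L : ℝ) ^ i.m * α₀) + KD * (c35 * (L : ℝ) ^ i.m * α₀) := by positivity
    have := mul_le_mul_of_nonneg_left h16 hS0
    exact mul_le_mul_of_nonneg_left (by linarith only [this]) hKz.le
  replace hZZ := fun p q => (hZZ p q).trans (mul_le_mul_of_nonneg_right hmid (Real.exp_nonneg _))
  -- (J-c′): the η-difference letter of the site objects
  have HSi := HS (cvM d L i.m i.kk hL) ι le_rfl (L ^ i.kk) (L ^ i.r * L ^ i.kk) (L ^ i.r) hLk hLrr rfl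
    (zAnyC d ι a hL i.m i.kk (Xc i A') (Dc i A') (Ec i A')) (zAnyF d ι a hL i.m i.kk i.r (Xf i A') (Df i A') (Ef i A')) _ _ hζ0 hζle hτ0 hZ hZ' hZZ
  -- the readout at unit sites
  have hη : (sfGeo d hL i).eta ≠ 0 := by
    show ((L : ℝ) ^ i.kk)⁻¹ ≠ 0
    exact inv_ne_zero (pow_ne_zero _ hLr.ne')
  have hlen : ∀ y : (sfGeo d hL i).Site, (sfGeo d hL i).len y = 1 := fun y => by
    show (L : ℝ) ^ i.kk * ((L : ℝ) ^ i.kk)⁻¹ = 1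
    exact mul_inv_cancel₀ (pow_ne_zero _ hLr.ne')
  refine etaRateIneqSite_opGeo_unit (g := sfGeo d hL i) (X := CvX d L i.m i.kk hL × ι) (blk := liftBlk (cvBlk d L i.m i.kk hL) ι)
    (foSiteAny d mm ι a hL α β j j' Xc Xf Dc Ec Df Ef i) hlen hη hLr (fun y y' => ?_) d' p
  rw [rateWeight_unitTorusGeoS, rateWeight_unitTorusGeoS, max_self, foSiteAny_ker,
    show (sfGeo d hL i).dist y y' = tdistT (cvM d L i.m i.kk hL) y y' from rfl]
  set M := cvM d L i.m i.kk hL with hMdef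
  set pp : B4.Idx (pbox M) (d + 1) × ι := ((⟨rep M y, rep_mem_pbox M y⟩, α), j) with hpp
  set qq : B4.Idx (pbox M) (d + 1) × ι := ((⟨rep M y', rep_mem_pbox M y'⟩, β), j') with hqq
  have hcd : cdist M ι pp qq = tdistT M y y' := by
    rw [cdist_eq, hpp, hqq]
    exact pdist_rep_rep M (one_le_M M) y y'
  have hS := HSi pp qq
  rw [hcd] at hS
  have hE := Real.exp_nonneg (-(δS * tdistT M y y'))
  -- the amplitude against `t = (L^k)^{−1∕16}` (`K_X r_A, K_D r_A ≤ 1`, `t ≤ 1`)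
  have hamp : C * (Kz * (KX * ((((L ^ i.kk : ℕ) : ℝ)) ^ (-γX)) +
      (KX * (c35 * (L : ℝ) ^ i.m * α₀) + KD * (c35 * (L : ℝ) ^ i.m * α₀) + KD * (c35 * (L : ℝ) ^ i.m * α₀)) * ((((L ^ i.kk : ℕ) : ℝ)) ^ (-γX)) +
      KD * ((((L ^ i.kk : ℕ) : ℝ)) ^ (-γX)) + KD * ((((L ^ i.kk : ℕ) : ℝ)) ^ (-γX))) + ((L ^ i.kk : ℕ) : ℝ)⁻¹)
      ≤ (C * (Kz * (KX + 3 + 2 * KD) + 1) + 1) * t := by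
    rw [hθt]
    have h3 : (KX * (c35 * (L : ℝ) ^ i.m * α₀) + KD * (c35 * (L : ℝ) ^ i.m * α₀) + KD * (c35 * (L : ℝ) ^ i.m * α₀)) * t ≤ 3 * t :=
      mul_le_mul_of_nonneg_right (by linarith) ht0
    have h4 : Kz * (KX * t + (KX * (c35 * (L : ℝ) ^ i.m * α₀) + KD * (c35 * (L : ℝ) ^ i.m * α₀) + KD * (c35 * (L : ℝ) ^ i.m * α₀)) * t + KD * t + KD * t) ≤
        Kz * (KX * t + 3 * t + KD * t + KD * t) := mul_le_mul_of_nonneg_left (by linarith) hKz.le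
    calc C * (Kz * (KX * t + (KX * (c35 * (L : ℝ) ^ i.m * α₀) + KD * (c35 * (L : ℝ) ^ i.m * α₀) + KD * (c35 * (L : ℝ) ^ i.m * α₀)) * t + KD * t + KD * t) + ((L ^ i.kk : ℕ) : ℝ)⁻¹)
        ≤ C * (Kz * (KX * t + 3 * t + KD * t + KD * t) + t) := mul_le_mul_of_nonneg_left (add_le_add h4 hinv) hC.le
      _ = (C * (Kz * (KX + 3 + 2 * KD) + 1)) * t := by ring
      _ ≤ (C * (Kz * (KX + 3 + 2 * KD) + 1) + 1) * t := mul_le_mul_of_nonneg_right (by linarith) ht0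
  calc _ ≤ C * (Kz * (KX * ((((L ^ i.kk : ℕ) : ℝ)) ^ (-γX)) +
          (KX * (c35 * (L : ℝ) ^ i.m * α₀) + KD * (c35 * (L : ℝ) ^ i.m * α₀) + KD * (c35 * (L : ℝ) ^ i.m * α₀)) * ((((L ^ i.kk : ℕ) : ℝ)) ^ (-γX)) +
          KD * ((((L ^ i.kk : ℕ) : ℝ)) ^ (-γX)) + KD * ((((L ^ i.kk : ℕ) : ℝ)) ^ (-γX))) + ((L ^ i.kk : ℕ) : ℝ)⁻¹) * Real.exp (-(δS * tdistT M y y')) := hS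
    _ ≤ ((C * (Kz * (KX + 3 + 2 * KD) + 1) + 1) * t) * Real.exp (-(δS * tdistT M y y')) := mul_le_mul_of_nonneg_right hamp hE
    _ = _ := by rw [ht_def]; ring

end SiteLayerRate

end Summit.QuantumFields.YangMills.BalabanUVNodes.N15.SiteLayerSf

end
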